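import Mathlib
import HarnessLib
import Literature.MathematicalPhysics.QuantumFieldTheory.ConstructiveQFTWave0
import Literature.MathematicalPhysics.QuantumFieldTheory.LatticeGaugeProofs
import Summits.Ventures.LatticeQCDFlow.Exactness.LatticeSiteResampling
import Summits.Ventures.LatticeQCDFlow.Exactness.LatticeCoordAvg
import Summits.Ventures.LatticeQCDFlow.Scaling.AutoregressiveGaugeRedundancy
import Summits.Ventures.LatticeQCDFlow.Scaling.AutoregressiveGaugeRedundancyWilson

/-!
# LatticeQCDFlow / Scaling — gauge redundancy of the autoregressive context, IV: the links of a
# forest are jointly Haar; generated first, their exact conditionals are identically one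

HONEST FRAMING: exact (Metropolis-corrected) sampling algorithms for lattice gauge theory;
figures of merit are autocorrelation/cost numbers at stated couplings and volumes; no
continuum-physics claim.

Venture `LatticeQCDFlow` (cell pub-lqcd), topic `Scaling`, FANOUT row 30 (lean-1, GEN-15) — OUR WORK,
fourth file on THEORY-2.md §4 row C5 for GAUGE links (I mechanism `AutoregressiveGaugeRedundancy`, II
Wilson plaquette-mate witness, III matchings).  The autoregressive face of maximal-tree gauge fixing
(M. Creutz, *Quarks, gluons and lattices* (1983) Ch. 9 — "links on a tree are pure gauge"; the tree's
`Scaling/LatticeTreeGauge` has the INTEGRATED form `∫ w = ∫ w(U[T ↦ 1])` for the comb), in MARGINAL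
form and for EVERY forest:

* §1 the TOWER step **`coordAvg_insert_eq_of_forall_update`**: if the partial marginal `A_s F`
  (`Exactness.coordAvg`) of a bounded measurable `F` does not read the link `ℓ ∉ s`, then integrating
  `ℓ` as well changes nothing: `A_{insert ℓ s} F = A_s F` (redraw one coordinate, tree
  `Exactness.integral_pi_eq_integral_integral_update'`, + Fubini).
* §2 FORESTS by PRUNING CERTIFICATE (def-free): a list of (link, site) pairs `(ℓ_1,x_1), …, (ℓ_k,x_k)`
  such that `x_m` is an endpoint of the non-loop `ℓ_m` touched by NO LATER `ℓ_n`, `n > m` (every forest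
  of links admits one — peel leaves — and every such list is a forest).
  **`coordAvg_forest_const`**: for a gauge-invariant bounded measurable `F`, the marginal
  `A_{(ℓ_1…ℓ_k)ᶜ} F` — a function of `U_{ℓ_1}, …, U_{ℓ_k}` only — is CONSTANT (burial of the leaf
  `ℓ_1` at `x_1`, file I, then the tower step, then induction), and equals `∫ F d(⊗Haar)`
  (`coordAvg_forest_eq_integral`, total mass from file II): **the links of a forest are jointly Haar
  distributed and independent under every lattice gauge theory `F · ⊗Haar`**.
* §3 THE AUTOREGRESSIVE READING: **`arConditional_forest_eq_one`** — generate the links of a forest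
  in any order; the exact conditional density of each of them given the ones before,
  `A_s F / A_{insert a s} F`, is IDENTICALLY `1` (`∫F ≠ 0`): Haar, context EMPTY — while the symbolic
  (plaquette-sharing, fill-neighbourhood) context grows with the forest.  On `(ℤ/L)^d` a spanning tree
  has `L^d − 1` links: the first `L^d − 1` steps of such a sampler carry no information at all.
* §4 the Wilson instance (`[SecondCountableTopology G]`, continuous `ρ`, any real `β`):
  `wilson_coordAvg_forest_eq_integral`, **`wilson_arConditional_forest_eq_one`**.

READING (value-free, for THEORY-2 §4 C5 / T2-AF): in link variables the exact autoregressive context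
of a lattice gauge theory is EMPTY along any generated forest (up to `L^d − 1` consecutive steps on
the torus), for every compact gauge group, representation and coupling; the graph-theoretic
(fill-neighbourhood) count of C5 / T2-AF (a) over-counts by the whole forest.  A faithful count must
be made for gauge-invariant content (e.g. the cotree links given a maximal tree, whose conditionals
read closed-loop holonomies).  NOT CLAIMED: anything about the conditionals of cotree links (the
first link closing a cycle reads exactly the holonomy of that cycle — expected, not typed); any lower
bound; any number of ours.  Elementary over the tree; no definition is introduced; nothing is cited as
a fact; no `sorry`.
-/

noncomputable section

namespace Summit.Ventures.LatticeQCDFlow.Theory2.Autoregressive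

open MeasureTheory Function
open Literature.MathematicalPhysics.QuantumFieldTheory
open Summit.Ventures.LatticeQCDFlow.Exactness

variable {d L N : ℕ} {G : Type*}

/-! ## §1 The tower step: integrating a link the marginal does not read changes nothing -/

section Tower

variable [MeasurableSpace G] (μ : Measure G) [IsProbabilityMeasure μ]

omit [MeasurableSpace G] in
/-- Gluing along `insert ℓ s` after redrawing `ℓ` is gluing along `s` into the updated retained
configuration (`ℓ ∉ s`). [ours] -/
theorem piecewise_insert_update [NeZero L] {s : Finset (Edge d L)} {ℓ : Edge d L} (hℓ : ℓ ∉ s)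
    (V U : GaugeConfig d L G) (v : G) :
    (insert ℓ s).piecewise (update V ℓ v) U = s.piecewise V (update U ℓ v) := by
  funext e
  by_cases he : e = ℓ
  · subst he
    simp [Finset.piecewise_eq_of_notMem _ _ _ hℓ]
  · by_cases hes : e ∈ s
    · simp [Finset.piecewise_eq_of_mem _ _ _ hes,
        Finset.piecewise_eq_of_mem _ _ _ (Finset.mem_insert_of_mem hes), he]
    · have : e ∉ insert ℓ s := by simp [he, hes]
      simp [Finset.piecewise_eq_of_notMem _ _ _ hes, Finset.piecewise_eq_of_notMem _ _ _ this, he]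

/-- **The tower step.**  If `A_s F` does not read the link `ℓ ∉ s` at `U` (`A_s F (U[ℓ ↦ h]) = A_s F U`
for all `h`), then `A_{insert ℓ s} F (U) = A_s F (U)`, for bounded measurable `F` and any product of
copies of a probability measure `μ` on `G`: redraw the `ℓ`-coordinate of the integrated sample first
(tree `integral_pi_eq_integral_integral_update'`), swap the integrals (Fubini), and use the
hypothesis inside. [ours] -/
theorem coordAvg_insert_eq_of_forall_update [NeZero L] {s : Finset (Edge d L)} {ℓ : Edge d L}
    (hℓ : ℓ ∉ s) {F : GaugeConfig d L G → ℝ} (hF : Measurable F) (hFb : ∃ C, ∀ U, |F U| ≤ C)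
    {U : GaugeConfig d L G} (hind : ∀ h : G, coordAvg μ s F (update U ℓ h) = coordAvg μ s F U) :
    coordAvg μ (insert ℓ s) F U = coordAvg μ s F U := by
  obtain ⟨C, hC⟩ := hFb
  have huniv : (fun _ : Edge d L => μ) ℓ Set.univ ≠ 0 := by simp
  -- integrability of the glued integrand and of its two-variable version
  have hm1 : Measurable fun V : GaugeConfig d L G => F ((insert ℓ s).piecewise V U) :=
    hF.comp ((measurable_piecewise_prod (insert ℓ s)).comp (measurable_const.prodMk measurable_id))
  have hint1 : Integrable (fun V : GaugeConfig d L G => F ((insert ℓ s).piecewise V U))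
      (Measure.pi fun _ : Edge d L => μ) :=
    Integrable.mono' (integrable_const C) hm1.aestronglyMeasurable
      (ae_of_all _ fun V => by rw [Real.norm_eq_abs]; exact hC _)
  have hm2 : Measurable fun p : GaugeConfig d L G × G => F (s.piecewise p.1 (update U ℓ p.2)) := by
    refine hF.comp ?_
    refine measurable_pi_iff.2 fun e => ?_
    by_cases hes : e ∈ s
    · simp only [Finset.piecewise_eq_of_mem _ _ _ hes]
      exact (measurable_pi_apply e).comp measurable_fst
    · simp only [Finset.piecewise_eq_of_notMem _ _ _ hes]
      by_cases he : e = ℓ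
      · subst he
        simp only [update_self]
        exact measurable_snd
      · simp only [update_of_ne he]
        exact measurable_const
  have hint2 : Integrable (fun p : GaugeConfig d L G × G => F (s.piecewise p.1 (update U ℓ p.2)))
      ((Measure.pi fun _ : Edge d L => μ).prod μ) :=
    Integrable.mono' (integrable_const C) hm2.aestronglyMeasurable
      (ae_of_all _ fun p => by rw [Real.norm_eq_abs]; exact hC _)
  -- redraw `ℓ`, swap, use the hypothesis
  calc coordAvg μ (insert ℓ s) F U
      = ∫ V, ∫ v, F ((insert ℓ s).piecewise (update V ℓ v) U) ∂μ
          ∂Measure.pi fun _ : Edge d L => μ := by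
        unfold coordAvg
        rw [integral_pi_eq_integral_integral_update' (fun _ : Edge d L => μ) ℓ huniv hint1]
        simp
    _ = ∫ V, ∫ v, F (s.piecewise V (update U ℓ v)) ∂μ ∂Measure.pi fun _ : Edge d L => μ := by
        simp only [piecewise_insert_update hℓ]
    _ = ∫ v, ∫ V, F (s.piecewise V (update U ℓ v)) ∂(Measure.pi fun _ : Edge d L => μ) ∂μ :=
        integral_integral_swap hint2
    _ = ∫ v, coordAvg μ s F (update U ℓ v) ∂μ := rfl
    _ = coordAvg μ s F U := by
        simp only [hind]
        rw [integral_const, smul_eq_mul, Measure.real, measure_univ, ENNReal.toReal_one, one_mul]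

end Tower

/-! ## §2 The links of a forest are jointly Haar -/

section Forest

variable [Group G] [TopologicalSpace G] [IsTopologicalGroup G] [CompactSpace G] [MeasurableSpace G]
  [BorelSpace G]

/-- **THE LINKS OF A FOREST ARE INVISIBLE TO EACH OTHER AND TO NOTHING ELSE: the marginal is
constant.**  Let `T = [(ℓ_1,x_1), …, (ℓ_k,x_k)]` be a PRUNING CERTIFICATE: each `ℓ_m` is not a loop,
`x_m` is one of its endpoints, and no later `ℓ_n` (`n > m`) touches `x_m`.  Then for every
gauge-invariant bounded measurable `F` the partial Haar marginal `A_{(ℓ_1,…,ℓ_k)ᶜ} F` — the marginal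
density of `(U_{ℓ_1}, …, U_{ℓ_k})` under `F·⊗Haar`, a function of these links only — takes the same
value on ALL configurations.  Induction: `ℓ_1` is buried at `x_1` by the complement (file I,
`coordAvg_update_of_buried`), so the marginal does not read it; by the tower step it equals the
marginal with `ℓ_1` integrated too, which is the case `[(ℓ_2,x_2), …]`. [ours] -/
theorem coordAvg_forest_const [NeZero L] {F : GaugeConfig d L G → ℝ} (hF : IsGaugeInvariant F)
    (hFm : Measurable F) (hFb : ∃ C, ∀ U, |F U| ≤ C) :
    ∀ (T : List (Edge d L × Site d L)),
      (∀ p ∈ T, (p.1.1 = p.2 ∨ p.1.1.shift p.1.2 = p.2) ∧ p.1.1 ≠ p.1.1.shift p.1.2) →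
      T.Pairwise (fun p q => ¬ (q.1.1 = p.2 ∨ q.1.1.shift q.1.2 = p.2)) →
      ∀ U U' : GaugeConfig d L G,
        coordAvg (haarProbability G) (Finset.univ \ (T.map Prod.fst).toFinset) F U =
          coordAvg (haarProbability G) (Finset.univ \ (T.map Prod.fst).toFinset) F U' := by
  intro T
  induction T with
  | nil =>
    intro _ _ U U'
    simp only [List.map_nil, List.toFinset_nil, Finset.sdiff_empty]
    exact coordAvg_congr_off Finset.univ F fun e he => absurd (Finset.mem_univ e) he
  | cons p T ih =>
    intro hinc hpw U U'
    obtain ⟨hp, hpw'⟩ := List.pairwise_cons.1 hpw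
    have hinc' : ∀ q ∈ T, (q.1.1 = q.2 ∨ q.1.1.shift q.1.2 = q.2) ∧ q.1.1 ≠ q.1.1.shift q.1.2 :=
      fun q hq => hinc q (List.mem_cons_of_mem _ hq)
    obtain ⟨hpinc, hploop⟩ := hinc p List.mem_cons_self
    -- the head link is not among the later ones (they do not touch its private endpoint)
    have hnot : p.1 ∉ (T.map Prod.fst).toFinset := by
      intro hmem
      rw [List.mem_toFinset, List.mem_map] at hmem
      obtain ⟨q, hq, hq1⟩ := hmem
      exact hp q hq (by rw [hq1]; exact hpinc)
    set s : Finset (Edge d L) := Finset.univ \ ((p :: T).map Prod.fst).toFinset with hs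
    have hs' : insert p.1 s = Finset.univ \ (T.map Prod.fst).toFinset := by
      ext e
      simp only [hs, List.map_cons, List.toFinset_cons, Finset.mem_insert, Finset.mem_sdiff,
        Finset.mem_univ, true_and, not_or]
      constructor
      · rintro (rfl | ⟨_, h2⟩)
        · exact hnot
        · exact h2
      · intro he
        by_cases hep : e = p.1
        · exact Or.inl hep
        · exact Or.inr ⟨hep, he⟩
    -- burial of the head link at its private endpoint
    have hbur : ∀ (V : GaugeConfig d L G) (h : G),
        coordAvg (haarProbability G) s F (update V p.1 h) = coordAvg (haarProbability G) s F V := by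
      intro V h
      refine coordAvg_update_of_buried hF hpinc hploop (fun e he hne => ?_) V h
      refine Finset.mem_sdiff.2 ⟨Finset.mem_univ _, fun hmem => ?_⟩
      simp only [List.map_cons, List.toFinset_cons, Finset.mem_insert, List.mem_toFinset,
        List.mem_map] at hmem
      rcases hmem with h1 | ⟨q, hq, hq1⟩
      · exact hne h1
      · exact hp q hq (by rw [hq1]; exact he)
    -- tower, then induction
    have htow : ∀ V : GaugeConfig d L G, coordAvg (haarProbability G) s F V =
        coordAvg (haarProbability G) (Finset.univ \ (T.map Prod.fst).toFinset) F V := by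
      intro V
      rw [← hs', coordAvg_insert_eq_of_forall_update (haarProbability G)
        (Finset.notMem_sdiff_of_mem_right (by simp)) hFm hFb (hbur V)]
    rw [htow U, htow U']
    exact ih hinc' hpw' U U'

/-- **The links of a forest are jointly Haar**: under the hypotheses of `coordAvg_forest_const` the
marginal is the constant `∫ F d(⊗Haar)` (total mass, file II `integral_coordAvg_eq`), i.e. the joint
density of `(U_{ℓ_1}, …, U_{ℓ_k})` against `⊗Haar` under the normalised weight is identically `1`. [ours] -/
theorem coordAvg_forest_eq_integral [NeZero L] {F : GaugeConfig d L G → ℝ} (hF : IsGaugeInvariant F)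
    (hFm : Measurable F) (hFb : ∃ C, ∀ U, |F U| ≤ C) (T : List (Edge d L × Site d L))
    (hinc : ∀ p ∈ T, (p.1.1 = p.2 ∨ p.1.1.shift p.1.2 = p.2) ∧ p.1.1 ≠ p.1.1.shift p.1.2)
    (hpw : T.Pairwise (fun p q => ¬ (q.1.1 = p.2 ∨ q.1.1.shift q.1.2 = p.2)))
    (U : GaugeConfig d L G) :
    coordAvg (haarProbability G) (Finset.univ \ (T.map Prod.fst).toFinset) F U =
      ∫ V, F V ∂Measure.pi fun _ : Edge d L => haarProbability G := by
  have hconst := coordAvg_forest_const hF hFm hFb T hinc hpw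
  have htot := integral_coordAvg_eq (haarProbability G) (Finset.univ \ (T.map Prod.fst).toFinset)
    hFm hFb
  -- a constant function integrates to its value
  have hc : (fun V => coordAvg (haarProbability G) (Finset.univ \ (T.map Prod.fst).toFinset) F V) =
      fun _ => coordAvg (haarProbability G) (Finset.univ \ (T.map Prod.fst).toFinset) F U :=
    funext fun V => hconst V U
  rw [hc, integral_const, smul_eq_mul, Measure.real, measure_univ, ENNReal.toReal_one, one_mul]
    at htot
  exact htot

/-! ## §3 The autoregressive reading: conditionals along a forest are identically one -/

/-- **EXACT AUTOREGRESSIVE CONDITIONALS ALONG A FOREST ARE IDENTICALLY ONE.**  Generate the links of a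
forest in any order; let `a` be the next forest link and `T` (with a pruning certificate for
`(a, y) :: T`, i.e. for the forest `T ∪ {a}`; the certificate of `T` alone follows) the ones already
generated; `s = (insert a T)ᶜ`.  Then for every gauge-invariant bounded measurable weight `F` with
`∫ F ≠ 0` the exact conditional density of `U_a` given `U_T`, `A_s F / A_{insert a s} F`, equals `1`
at every configuration: `U_a` is Haar and independent of everything generated so far — the context is
EMPTY, although the symbolic (plaquette-sharing) context of `a` contains every generated link joined
to `a` through ungenerated ones. [ours] -/
theorem arConditional_forest_eq_one [NeZero L] {F : GaugeConfig d L G → ℝ} (hF : IsGaugeInvariant F)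
    (hFm : Measurable F) (hFb : ∃ C, ∀ U, |F U| ≤ C)
    (hF0 : ∫ V, F V ∂Measure.pi (fun _ : Edge d L => haarProbability G) ≠ 0)
    (a : Edge d L) (y : Site d L) (T : List (Edge d L × Site d L))
    (hinc : ∀ p ∈ (a, y) :: T, (p.1.1 = p.2 ∨ p.1.1.shift p.1.2 = p.2) ∧ p.1.1 ≠ p.1.1.shift p.1.2)
    (hpw : ((a, y) :: T).Pairwise (fun p q => ¬ (q.1.1 = p.2 ∨ q.1.1.shift q.1.2 = p.2)))
    (U : GaugeConfig d L G) :
    coordAvg (haarProbability G) (Finset.univ \ (((a, y) :: T).map Prod.fst).toFinset) F U /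
      coordAvg (haarProbability G)
        (insert a (Finset.univ \ (((a, y) :: T).map Prod.fst).toFinset)) F U = 1 := by
  obtain ⟨hp, hpw'⟩ := List.pairwise_cons.1 hpw
  have hinc' : ∀ q ∈ T, (q.1.1 = q.2 ∨ q.1.1.shift q.1.2 = q.2) ∧ q.1.1 ≠ q.1.1.shift q.1.2 :=
    fun q hq => hinc q (List.mem_cons_of_mem _ hq)
  have hainc := (hinc (a, y) List.mem_cons_self).1
  have hnot : a ∉ (T.map Prod.fst).toFinset := by
    intro hmem
    rw [List.mem_toFinset, List.mem_map] at hmem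
    obtain ⟨q, hq, hq1⟩ := hmem
    exact hp q hq (by rw [hq1]; exact hainc)
  have hs' : insert a (Finset.univ \ (((a, y) :: T).map Prod.fst).toFinset) =
      Finset.univ \ (T.map Prod.fst).toFinset := by
    ext e
    simp only [List.map_cons, List.toFinset_cons, Finset.mem_insert, Finset.mem_sdiff,
      Finset.mem_univ, true_and, not_or]
    constructor
    · rintro (rfl | ⟨_, h2⟩)
      · exact hnot
      · exact h2
    · intro he
      by_cases hea : e = a
      · exact Or.inl hea
      · exact Or.inr ⟨hea, he⟩
  rw [hs', coordAvg_forest_eq_integral hF hFm hFb ((a, y) :: T) hinc hpw U,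
    coordAvg_forest_eq_integral hF hFm hFb T hinc' hpw' U, div_self hF0]

end Forest

/-! ## §4 The Wilson instance -/

section Wilson

variable [Group G] [TopologicalSpace G] [IsTopologicalGroup G] [CompactSpace G] [MeasurableSpace G]
  [BorelSpace G] [SecondCountableTopology G] (ρ : G →* Matrix (Fin N) (Fin N) ℂ)

/-- The Wilson weight `e^{−β S_W}` of a continuous representation is measurable and bounded
(tree `measurable_wilsonAction`, `exists_abs_wilsonAction_le`). [ours] -/
theorem wilsonWeightFun_measurable_bounded [NeZero L] (hρ : Continuous ρ) (β : ℝ) :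
    Measurable (fun U : GaugeConfig d L G => Real.exp (-β * wilsonAction ρ U)) ∧
      ∃ C, ∀ U : GaugeConfig d L G, |Real.exp (-β * wilsonAction ρ U)| ≤ C := by
  refine ⟨Real.measurable_exp.comp (measurable_const.mul (measurable_wilsonAction ρ hρ)), ?_⟩
  obtain ⟨B, hB⟩ := exists_abs_wilsonAction_le (d := d) (L := L) ρ hρ
  refine ⟨Real.exp (|β| * B), fun U => ?_⟩
  rw [abs_of_pos (Real.exp_pos _)]
  refine Real.exp_le_exp.2 ?_
  calc -β * wilsonAction ρ U ≤ |-β * wilsonAction ρ U| := le_abs_self _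
    _ = |β| * |wilsonAction ρ U| := by rw [abs_mul, abs_neg]
    _ ≤ |β| * B := mul_le_mul_of_nonneg_left (hB U) (abs_nonneg β)

/-- The Wilson weight has non-zero (positive) total mass against product Haar measure. [ours] -/
theorem integral_wilsonWeightFun_ne_zero [NeZero L] (hρ : Continuous ρ) (β : ℝ) :
    ∫ V, Real.exp (-β * wilsonAction ρ V) ∂Measure.pi (fun _ : Edge d L => haarProbability G) ≠ 0 := by
  obtain ⟨hm, C, hC⟩ := wilsonWeightFun_measurable_bounded (d := d) (L := L) ρ hρ β
  have hint : Integrable (fun V : GaugeConfig d L G => Real.exp (-β * wilsonAction ρ V))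
      (Measure.pi fun _ : Edge d L => haarProbability G) :=
    Integrable.mono' (integrable_const C) hm.aestronglyMeasurable
      (ae_of_all _ fun V => by rw [Real.norm_eq_abs]; exact hC _)
  exact (integral_exp_pos hint).ne'

/-- **Wilson theory: the links of a forest are jointly Haar.**  Every compact second-countable `G`,
continuous `ρ`, real `β`, every `d`, `L`, every pruning certificate `T`: the Wilson marginal of the
forest links is the constant `Z = ∫ e^{−β S_W} d(⊗Haar)`. [ours] -/
theorem wilson_coordAvg_forest_eq_integral [NeZero L] (hρ : Continuous ρ) (β : ℝ)
    (T : List (Edge d L × Site d L))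
    (hinc : ∀ p ∈ T, (p.1.1 = p.2 ∨ p.1.1.shift p.1.2 = p.2) ∧ p.1.1 ≠ p.1.1.shift p.1.2)
    (hpw : T.Pairwise (fun p q => ¬ (q.1.1 = p.2 ∨ q.1.1.shift q.1.2 = p.2)))
    (U : GaugeConfig d L G) :
    coordAvg (haarProbability G) (Finset.univ \ (T.map Prod.fst).toFinset)
        (fun U => Real.exp (-β * wilsonAction ρ U)) U =
      ∫ V, Real.exp (-β * wilsonAction ρ V) ∂Measure.pi fun _ : Edge d L => haarProbability G := by
  obtain ⟨hm, hb⟩ := wilsonWeightFun_measurable_bounded (d := d) (L := L) ρ hρ β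
  exact coordAvg_forest_eq_integral (isGaugeInvariant_wilsonWeightFun ρ β) hm hb T hinc hpw U

/-- **Wilson theory: exact autoregressive conditionals along a forest are identically one.**  Every
compact second-countable `G`, continuous `ρ`, real `β`: generating the links of a forest first (up to
the `L^d − 1` links of a spanning tree of `(ℤ/L)^d`), in any order, every exact conditional density
`A_s w / A_{insert a s} w` equals `1` — each of these links is Haar, independent of all links generated
before it; the true context is empty while the symbolic context is the generated forest. [ours] -/
theorem wilson_arConditional_forest_eq_one [NeZero L] (hρ : Continuous ρ) (β : ℝ) (a : Edge d L)
    (y : Site d L) (T : List (Edge d L × Site d L))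
    (hinc : ∀ p ∈ (a, y) :: T, (p.1.1 = p.2 ∨ p.1.1.shift p.1.2 = p.2) ∧ p.1.1 ≠ p.1.1.shift p.1.2)
    (hpw : ((a, y) :: T).Pairwise (fun p q => ¬ (q.1.1 = p.2 ∨ q.1.1.shift q.1.2 = p.2)))
    (U : GaugeConfig d L G) :
    coordAvg (haarProbability G) (Finset.univ \ (((a, y) :: T).map Prod.fst).toFinset)
        (fun U => Real.exp (-β * wilsonAction ρ U)) U /
      coordAvg (haarProbability G) (insert a (Finset.univ \ (((a, y) :: T).map Prod.fst).toFinset))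
        (fun U => Real.exp (-β * wilsonAction ρ U)) U = 1 := by
  obtain ⟨hm, hb⟩ := wilsonWeightFun_measurable_bounded (d := d) (L := L) ρ hρ β
  exact arConditional_forest_eq_one (isGaugeInvariant_wilsonWeightFun ρ β) hm hb
    (integral_wilsonWeightFun_ne_zero ρ hρ β) a y T hinc hpw U

end Wilson

end Summit.Ventures.LatticeQCDFlow.Theory2.Autoregressive

end
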